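import Literature.AlgebraicGeometry.Morphisms.SectionsRankOfFibreVanishing
import Literature.AlgebraicGeometry.Modules.SerreTwistModBaseChange
import Literature.AlgebraicGeometry.Morphisms.ProjectiveSpaceOverBasePoints
import Mathlib.AlgebraicGeometry.Morphisms.Flat
import Mathlib.AlgebraicGeometry.Morphisms.Separated
import HarnessLib

/-!
# Embedded families `Z ⊆ 𝐏(ι; T)` and graph families under base change

Layer `Literature/AlgebraicGeometry/Morphisms`, namespace `Literature.AlgebraicGeometry.Morphisms`.  Theorems only: no definition, no
named fact, no instance, no notation, no `sorry`.

Bookkeeping for the Hom-scheme `Hom_S(Y, X)` as an open-of-closed piece of the Hilbert scheme of `Y ×_S X ⊂ 𝐏(ι; S)`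
([MumfordFogartyKirwan1994] Ch. 0 §5 (c) (p. 23); [FGA] no. 221 §4.c), in the tree's model `𝐏(ι; T) = T ×_ℤ 𝐏ⁿ_ℤ` with
`projectiveSpaceMap ι w : 𝐏(ι; T') → 𝐏(ι; T)` (★ `Morphisms/ProjectiveSpaceOverBasePoints`, `isPullback_projectiveSpaceMap`):

* §1 `projectiveSpaceMap_comp` — `𝐏(ι; -)` is functorial: `𝐏(w ≫ v) = 𝐏(w) ≫ 𝐏(v)`; `projectiveSpaceMap_id`.
* §2 `isPullback_family_baseChange` — for an embedded family `iV : Z_V ↪ 𝐏(ι; V)` which is the pull-back of `iH : Z_H ↪ 𝐏(ι; H)` along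
  `𝐏(c)` (`c : V → H`) and any `b : T → V`, the base change `Z_V ×_V T` embedded in `𝐏(ι; T)` is the pull-back of `iH` along `𝐏(b ≫ c)`
  (pasting of cartesian squares, [GortzWedhorn2020] Section (4.7) ∕ (4.12)); `exists_embedding_baseChange` gives the embedding.
* §3 `isPullback_map_graphFamily` — the GRAPH FAMILY `iΓ : Y_T ↪ 𝐏(ι; T)` of a `T`-morphism `φ : Y_T → X_T` (read through a fixed
  `jW : Y ×_S X ↪ 𝐏(ι; S)`: `iΓ ≫ pr_T = pr_T`, `iΓ ≫ 𝐏(v) = (pr_Y, φ ≫ pr_X) ≫ jW`) is compatible with base change: for `w : T' → T` and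
  `φ' = w^*φ` (intertwined by Mathlib's comparison maps `pullback.map _ _ _ _ (𝟙 _) w (𝟙 S)`), the square `(w^*, iΓ'; iΓ, 𝐏(w))` is
  CARTESIAN — «the graph of the base change is the base change of the graph» ([GortzWedhorn2020] Section (4.7), Def. 9.7).
* §5 `exists_graphFamily_of_over`, `isClosedImmersion_graphFamily_of_over`, `flat_graphFamily_fst_of_over` — the graph family
  `iΓ : Y_T ↪ 𝐏(ι; T)` of `φ` exists, is a CLOSED IMMERSION (a section of the separated `W_T → Y_T` followed by `W_T ↪ 𝐏(ι; T)`;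
  [GortzWedhorn2020] Def. 9.7 ∕ Ex. 9.11) and is flat over `T` when `q` is — after B-p14 (g20)'s HOME file `Morphisms/GraphFamilyEmbedding`
  (0bfc088a), restated here with the explicit `hw` binder of the Hom-scheme letters.
* §4 `letters_of_isPullback_projectiveSpaceMap` — a field point `x'` of `T'` of a base-changed family `Z' = Z ×_{𝐏(ι;T)} 𝐏(ι; T')` reads
  the fibre of `Z` at `x' ≫ v` and the same twisted module `k'^*𝒪_{Z'}(e) ≅ (k' ≫ g)^*𝒪_Z(e)` (★ `SerreTwist.exists_pullback_twistMod_unitModule_iso`),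
  so the two letters of cohomology-and-base-change («`Ext¹(𝒪_{X₀}, k^*𝒪_Z(e)) = 0`», «`dim_K Γ(X₀, k^*𝒪_Z(e)) = r`») pass from `Z ∕ T`
  at `x' ≫ v` to `Z' ∕ T'` at `x'` ([Hartshorne1977] III Thm. 9.9: Hilbert polynomials are constant under base change).

Cell hodgecm-mathlib, F-4 (II-b) Hom-scheme, child line `F4IIbHomScheme` stub (B4) (F0P1a-p02 (g0)).  Count-neutral capital: HC_CM is proved
only modulo the 7 printed citations until rung 0 closes; nothing here bears on it.

## References
* D. Mumford, J. Fogarty, F. Kirwan, *Geometric Invariant Theory* (3rd ed., 1994), Ch. 0 §5 (c) (p. 23). [MumfordFogartyKirwan1994]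
* U. Görtz, T. Wedhorn, *Algebraic Geometry I* (2nd ed., 2020), Sections (4.7), (4.12), Def. 9.7. [GortzWedhorn2020]
* R. Hartshorne, *Algebraic Geometry*, GTM 52 (1977), II Prop. 5.12 (c), III Thm. 9.9 (p. 261). [Hartshorne1977]
* The Stacks Project, Tag 01NF (base change of `𝐏ⁿ_S`). [StacksProject]
-/

noncomputable section

set_option backward.isDefEq.respectTransparency false

open CategoryTheory CategoryTheory.Limits CategoryTheory.Abelian AlgebraicGeometry Polynomial
open Literature.AlgebraicGeometry.Modules Literature.AlgebraicGeometry.Modules.SerreTwist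
open Literature.Algebra.Homology Literature.Algebra.Homology.LaurentCech Literature.Algebra.Homology.OrderedCech

universe u

namespace Literature.AlgebraicGeometry.Morphisms

/-! ## §1 Functoriality of `𝐏(ι; -)` -/

/-- **`𝐏(ι; w ≫ v) = 𝐏(ι; w) ≫ 𝐏(ι; v)`** (both are `(w ≫ v) × 𝟙` on `T' ×_ℤ 𝐏ⁿ_ℤ`). [cite: StacksProject, Tag 01NF]
[cite: GortzWedhorn2020, Section (4.12)] -/
@[reassoc]
theorem projectiveSpaceMap_comp (ι : Type u) {T' T S : Scheme.{u}} (w : T' ⟶ T) (v : T ⟶ S) :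
    Morphisms.projectiveSpaceMap ι (w ≫ v) = Morphisms.projectiveSpaceMap ι w ≫ Morphisms.projectiveSpaceMap ι v := by
  apply pullback.hom_ext
  · simp only [Category.assoc, Morphisms.projectiveSpaceMap_fst, Morphisms.projectiveSpaceMap_fst_assoc]
  · simp only [Category.assoc, Morphisms.projectiveSpaceMap_snd]

/-- `𝐏(ι; 𝟙_T) = 𝟙`. [cite: StacksProject, Tag 01NF] -/
theorem projectiveSpaceMap_id (ι : Type u) (T : Scheme.{u}) :
    Morphisms.projectiveSpaceMap ι (𝟙 T) = 𝟙 (Morphisms.projectiveSpace ι T) := by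
  apply pullback.hom_ext
  · simp only [Morphisms.projectiveSpaceMap_fst, Category.comp_id, Category.id_comp]
  · simp only [Morphisms.projectiveSpaceMap_snd, Category.id_comp]

/-! ## §2 Base change of an embedded family that is itself a pull-back -/

section Family

variable {ι : Type u} {H V ZH ZV T ZT : Scheme.{u}} (c : V ⟶ H) (iH : ZH ⟶ Morphisms.projectiveSpace ι H)
  (iV : ZV ⟶ Morphisms.projectiveSpace ι V) (gH : ZV ⟶ ZH) (b : T ⟶ V) (fT : ZT ⟶ ZV) (sT : ZT ⟶ T)

/-- **The embedding of a base change.**  If `Z_T` is the base change of `Z_V → V` (structure map `iV ≫ pr_V`) along `b : T → V`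
(`IsPullback fT sT (iV ≫ pr_V) b`), then `Z_T` embeds in `𝐏(ι; T) = 𝐏(ι; V) ×_V T` by `(fT ≫ iV, sT)`.
[cite: GortzWedhorn2020, Section (4.12)] [cite: StacksProject, Tag 01NF] -/
theorem exists_embedding_baseChange (HT : IsPullback fT sT (iV ≫ Morphisms.projectiveSpaceFst ι V) b) :
    ∃ iT : ZT ⟶ Morphisms.projectiveSpace ι T,
      iT ≫ Morphisms.projectiveSpaceMap ι b = fT ≫ iV ∧ iT ≫ Morphisms.projectiveSpaceFst ι T = sT :=
  have hw : (fT ≫ iV) ≫ Morphisms.projectiveSpaceFst ι V = sT ≫ b := by rw [Category.assoc, HT.w]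
  ⟨(Morphisms.isPullback_projectiveSpaceMap ι b).lift (fT ≫ iV) sT hw,
    (Morphisms.isPullback_projectiveSpaceMap ι b).lift_fst _ _ hw, (Morphisms.isPullback_projectiveSpaceMap ι b).lift_snd _ _ hw⟩

/-- **Such an embedding is the base change of `iV` along `𝐏(b)`**: the square `(fT, iT; iV, 𝐏(b))` is cartesian (the rectangle
`Z_T → 𝐏(ι; T) → T` over `Z_V → 𝐏(ι; V) → V` is, and so is its right half `𝐏(ι; T) = 𝐏(ι; V) ×_V T`).
[cite: GortzWedhorn2020, Section (4.7) and Section (4.12)] -/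
theorem isPullback_embedding_baseChange (HT : IsPullback fT sT (iV ≫ Morphisms.projectiveSpaceFst ι V) b)
    (iT : ZT ⟶ Morphisms.projectiveSpace ι T) (hiT₁ : iT ≫ Morphisms.projectiveSpaceMap ι b = fT ≫ iV)
    (hiT₂ : iT ≫ Morphisms.projectiveSpaceFst ι T = sT) : IsPullback fT iT iV (Morphisms.projectiveSpaceMap ι b) := by
  refine (IsPullback.of_right (h₁₁ := iT) (h₁₂ := Morphisms.projectiveSpaceFst ι T) (v₁₁ := fT)
    (v₁₂ := Morphisms.projectiveSpaceMap ι b) (v₁₃ := b) (h₂₁ := iV) (h₂₂ := Morphisms.projectiveSpaceFst ι V) ?_ hiT₁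
    (Morphisms.isPullback_projectiveSpaceMap ι b).flip).flip
  rw [hiT₂]
  exact HT.flip

/-- **Base change of a pulled-back family.**  If moreover `iV : Z_V ↪ 𝐏(ι; V)` is the pull-back of `iH : Z_H ↪ 𝐏(ι; H)` along `𝐏(c)`
(`IsPullback gH iV iH 𝐏(c)`), then `Z_T ⊆ 𝐏(ι; T)` is the pull-back of `iH` along `𝐏(b ≫ c)` (horizontal pasting and §1).
[cite: GortzWedhorn2020, Section (4.7) and Section (4.12)] -/
theorem isPullback_family_baseChange (HV : IsPullback gH iV iH (Morphisms.projectiveSpaceMap ι c))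
    (HT : IsPullback fT sT (iV ≫ Morphisms.projectiveSpaceFst ι V) b)
    (iT : ZT ⟶ Morphisms.projectiveSpace ι T) (hiT₁ : iT ≫ Morphisms.projectiveSpaceMap ι b = fT ≫ iV)
    (hiT₂ : iT ≫ Morphisms.projectiveSpaceFst ι T = sT) :
    IsPullback (fT ≫ gH) iT iH (Morphisms.projectiveSpaceMap ι (b ≫ c)) := by
  rw [projectiveSpaceMap_comp]
  exact (isPullback_embedding_baseChange iV b fT sT HT iT hiT₁ hiT₂).paste_horiz HV

end Family

/-! ## §3 The graph family under base change -/

section GraphFamily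

variable {S Y X : Scheme.{u}} (q : Y ⟶ S) (p : X ⟶ S) {ι : Type u} (jW : pullback q p ⟶ Morphisms.projectiveSpace ι S)

/-- **The base change `Y_{T'} = Y_T ×_T T'`** through Mathlib's comparison map `pullback.map q v' q v (𝟙 Y) w (𝟙 S)` (`v' = w ≫ v`).
[cite: GortzWedhorn2020, Section (4.7)] -/
theorem isPullback_map_snd_snd {T T' : Scheme.{u}} (v : T ⟶ S) (w : T' ⟶ T) (v' : T' ⟶ S) (hv' : w ≫ v = v') :
    IsPullback (pullback.map q v' q v (𝟙 Y) w (𝟙 S) (by simp) (by simpa using hv'.symm)) (pullback.snd q v')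
      (pullback.snd q v) w := by
  subst hv'
  refine IsPullback.of_right (h₁₂ := pullback.fst q v) (v₁₃ := q) (h₂₂ := v) ?_ (by simp) (IsPullback.of_hasPullback q v)
  rw [pullback.lift_fst, Category.comp_id]
  exact IsPullback.of_hasPullback q (w ≫ v)

/-- **The graph of the base change is the base change of the graph** ([GortzWedhorn2020] (4.7), Def. 9.7), for graph FAMILIES in
`𝐏(ι; -)`: let `iΓ : Y_T → 𝐏(ι; T)` be the graph family of the `T`-morphism `φ` (`iΓ ≫ pr_T = pr_T`, `iΓ ≫ 𝐏(v) = (pr_Y, φ ≫ pr_X) ≫ jW`)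
and `iΓ'` that of `φ'` over `T'`, where `φ'` is the base change of `φ` along `w : T' → T` (`φ' ≫ (X-comparison) = (Y-comparison) ≫ φ`);
then `(Y-comparison, iΓ'; iΓ, 𝐏(w))` is CARTESIAN. [cite: GortzWedhorn2020, Section (4.7) and Definition 9.7]
[cite: MumfordFogartyKirwan1994, Ch. 0 §5 (c) (p. 23)] -/
theorem isPullback_map_graphFamily {T : Scheme.{u}} (v : T ⟶ S) (φ : pullback q v ⟶ pullback p v)
    (hw : pullback.fst q v ≫ q = (φ ≫ pullback.fst p v) ≫ p)
    (iΓ : pullback q v ⟶ Morphisms.projectiveSpace ι T) (h₁ : iΓ ≫ Morphisms.projectiveSpaceFst ι T = pullback.snd q v)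
    (h₂ : iΓ ≫ Morphisms.projectiveSpaceMap ι v = pullback.lift (pullback.fst q v) (φ ≫ pullback.fst p v) hw ≫ jW)
    {T' : Scheme.{u}} (w : T' ⟶ T) (v' : T' ⟶ S) (hv' : w ≫ v = v') (φ' : pullback q v' ⟶ pullback p v')
    (hw' : pullback.fst q v' ≫ q = (φ' ≫ pullback.fst p v') ≫ p)
    (hφφ' : φ' ≫ pullback.map p v' p v (𝟙 X) w (𝟙 S) (by simp) (by simpa using hv'.symm) =
      pullback.map q v' q v (𝟙 Y) w (𝟙 S) (by simp) (by simpa using hv'.symm) ≫ φ)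
    (iΓ' : pullback q v' ⟶ Morphisms.projectiveSpace ι T') (h₁' : iΓ' ≫ Morphisms.projectiveSpaceFst ι T' = pullback.snd q v')
    (h₂' : iΓ' ≫ Morphisms.projectiveSpaceMap ι v' = pullback.lift (pullback.fst q v') (φ' ≫ pullback.fst p v') hw' ≫ jW) :
    IsPullback (pullback.map q v' q v (𝟙 Y) w (𝟙 S) (by simp) (by simpa using hv'.symm)) iΓ' iΓ
      (Morphisms.projectiveSpaceMap ι w) := by
  have sq := isPullback_map_snd_snd q v w v' hv'
  subst hv'
  refine (IsPullback.of_right (h₁₁ := iΓ') (h₁₂ := Morphisms.projectiveSpaceFst ι T')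
    (v₁₁ := pullback.map q (w ≫ v) q v (𝟙 Y) w (𝟙 S) (by simp) (by simp))
    (v₁₂ := Morphisms.projectiveSpaceMap ι w) (v₁₃ := w) (h₂₁ := iΓ) (h₂₂ := Morphisms.projectiveSpaceFst ι T) ?_ ?_
    (Morphisms.isPullback_projectiveSpaceMap ι w).flip).flip
  · rw [h₁', h₁]
    exact sq.flip
  · -- `iΓ' ≫ 𝐏(w) = (Y-comparison) ≫ iΓ`: compare the components in `𝐏(ι; T) = 𝐏(ι; S) ×_S T`
    apply (Morphisms.isPullback_projectiveSpaceMap ι v).hom_ext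
    · rw [Category.assoc, ← projectiveSpaceMap_comp, h₂', Category.assoc, h₂, ← Category.assoc]
      congr 1
      apply pullback.hom_ext
      · simp only [pullback.lift_fst, Category.assoc, Category.comp_id]
      · simp only [pullback.lift_snd, Category.assoc]
        have h := congrArg (· ≫ pullback.fst p v) hφφ'
        simpa only [Category.assoc, pullback.lift_fst, Category.comp_id] using h
    · rw [Category.assoc, Morphisms.projectiveSpaceMap_fst, reassoc_of% h₁', Category.assoc, h₁, pullback.lift_snd]

end GraphFamily

/-! ## §4 The letters of cohomology-and-base-change pass to a base-changed family -/

section Letters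

/-- `Ext`-vanishing transports along an isomorphism of the second argument. [folklore] -/
private theorem subsingleton_ext_of_iso₅ {C : Type*} [Category C] [Abelian C] [HasExt.{1} C] (P : C) {Y Y' : C}
    (e : Y ≅ Y') (i : ℕ) (h : Subsingleton (Ext.{1} P Y' i)) : Subsingleton (Ext.{1} P Y i) := by
  refine subsingleton_of_forall_eq 0 fun x => ?_
  have hx : x = (x.comp (Ext.mk₀ e.hom) (add_zero i)).comp (Ext.mk₀ e.inv) (add_zero i) := by
    rw [Ext.comp_assoc_of_second_deg_zero, Ext.mk₀_comp_mk₀, e.hom_inv_id, Ext.comp_mk₀_id]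
  rw [hx, Subsingleton.elim (x.comp (Ext.mk₀ e.hom) (add_zero i)) 0, Ext.zero_comp]

variable {ι : Type} {T Z T' Z' : Scheme.{0}} (i : Z ⟶ Morphisms.projectiveSpace ι T) (v : T' ⟶ T) (g : Z' ⟶ Z)
  (i' : Z' ⟶ Morphisms.projectiveSpace ι T')

/-- **A field point of a base change reads the fibre of `Z` and the same twisted module.**  For `v : T' → T`, a cartesian square
`g : Z' → Z` over `𝐏(v)` (`Z' = Z ×_T T'` embedded by `i'`) and a cartesian square `(k', f₀)` of `Z'` over a field point `x'` of `T'`: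
`(k' ≫ g, f₀)` is a cartesian square of `Z` over `x' ≫ v`, and `(k' ≫ g)^*𝒪_Z(e) ≅ k'^*𝒪_{Z'}(e)` (`i' ≫ pr₂ = g ≫ i ≫ pr₂`, ★
`SerreTwist.exists_pullback_twistMod_unitModule_iso`). [cite: Hartshorne1977, II Prop. 5.12 (c)] [cite: StacksProject, Tag 01NF] -/
theorem isPullback_fieldPoint_and_twistMod_iso_of_isPullback_projectiveSpaceMap
    (Hg : IsPullback g i' i (Morphisms.projectiveSpaceMap ι v))
    {K : Type} [Field K] {X₀ : Scheme.{0}} (k' : X₀ ⟶ Z') (f₀ : X₀ ⟶ Spec (CommRingCat.of K))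
    (x' : Spec (CommRingCat.of K) ⟶ T') (H' : IsPullback k' f₀ (i' ≫ Morphisms.projectiveSpaceFst ι T') x') :
    IsPullback (k' ≫ g) f₀ (i ≫ Morphisms.projectiveSpaceFst ι T) (x' ≫ v) ∧
      ∀ e : ℕ, Nonempty ((Scheme.Modules.pullback (k' ≫ g)).obj
          (twistMod (i ≫ pullback.snd (terminal.from T) (terminal.from (Morphisms.projectiveSpaceInt ι))) (unitModule Z) e) ≅
        (Scheme.Modules.pullback k').obj
          (twistMod (i' ≫ pullback.snd (terminal.from T') (terminal.from (Morphisms.projectiveSpaceInt ι))) (unitModule Z') e)) := by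
  have HZ : IsPullback g (i' ≫ Morphisms.projectiveSpaceFst ι T') (i ≫ Morphisms.projectiveSpaceFst ι T) v :=
    Hg.paste_vert (Morphisms.isPullback_projectiveSpaceMap ι v)
  refine ⟨H'.paste_horiz HZ, fun e => ?_⟩
  have hsnd : i' ≫ pullback.snd (terminal.from T') (terminal.from (Morphisms.projectiveSpaceInt ι)) =
      g ≫ (i ≫ pullback.snd (terminal.from T) (terminal.from (Morphisms.projectiveSpaceInt ι))) := by
    rw [← Morphisms.projectiveSpaceMap_snd ι v, ← Category.assoc, ← Hg.w, Category.assoc]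
  obtain ⟨φ, -⟩ := exists_pullback_twistMod_unitModule_iso g
    (i ≫ pullback.snd (terminal.from T) (terminal.from (Morphisms.projectiveSpaceInt ι))) e
  have hobj : twistMod (i' ≫ pullback.snd (terminal.from T') (terminal.from (Morphisms.projectiveSpaceInt ι))) (unitModule Z') e =
      twistMod (g ≫ (i ≫ pullback.snd (terminal.from T) (terminal.from (Morphisms.projectiveSpaceInt ι)))) (unitModule Z') e :=
    congrArg (fun f => twistMod f (unitModule Z') e) hsnd
  exact ⟨((Scheme.Modules.pullbackComp k' g).app _).symm ≪≫ (Scheme.Modules.pullback k').mapIso (φ ≪≫ eqToIso hobj.symm)⟩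

/-- **The two letters pass to a base change** ([Hartshorne1977] III Thm. 9.9: the Hilbert polynomial is constant under base change).
With the data above, if at the field point `x' ≫ v` of `T` every cartesian square `(k, f₀)` of `Z` has `Ext¹(𝒪_{X₀}, k^*𝒪_Z(e)) = 0` and
`dim_K Γ(X₀, k^*𝒪_Z(e)) = r`, then so does the square `(k', f₀)` of `Z'` at `x'`: `Ext¹(𝒪_{X₀}, k'^*𝒪_{Z'}(e)) = 0` and
`dim_K Γ(X₀, k'^*𝒪_{Z'}(e)) = r`. [cite: Hartshorne1977, III Thm. 9.9 (p. 261)] [cite: EGAIII2, 7.9.11] -/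
theorem letters_of_isPullback_projectiveSpaceMap (Hg : IsPullback g i' i (Morphisms.projectiveSpaceMap ι v))
    {K : Type} [Field K] {X₀ : Scheme.{0}} (k' : X₀ ⟶ Z') (f₀ : X₀ ⟶ Spec (CommRingCat.of K))
    (x' : Spec (CommRingCat.of K) ⟶ T') (H' : IsPullback k' f₀ (i' ≫ Morphisms.projectiveSpaceFst ι T') x') (e : ℕ) (r : ℚ)
    (h : ∀ k : X₀ ⟶ Z, IsPullback k f₀ (i ≫ Morphisms.projectiveSpaceFst ι T) (x' ≫ v) →
      Subsingleton (Ext.{1} (unitModule X₀) ((Scheme.Modules.pullback k).obj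
        (twistMod (i ≫ pullback.snd (terminal.from T) (terminal.from (Morphisms.projectiveSpaceInt ι))) (unitModule Z) e)) 1) ∧
      ((Module.finrank Γ(Spec (CommRingCat.of K), ⊤) (SecMod ((Scheme.Modules.pullback k).obj
        (twistMod (i ≫ pullback.snd (terminal.from T) (terminal.from (Morphisms.projectiveSpaceInt ι))) (unitModule Z) e))
        f₀.appTop.hom ⊤) : ℕ) : ℚ) = r) :
    Subsingleton (Ext.{1} (unitModule X₀) ((Scheme.Modules.pullback k').obj
        (twistMod (i' ≫ pullback.snd (terminal.from T') (terminal.from (Morphisms.projectiveSpaceInt ι))) (unitModule Z') e)) 1) ∧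
      ((Module.finrank Γ(Spec (CommRingCat.of K), ⊤) (SecMod ((Scheme.Modules.pullback k').obj
        (twistMod (i' ≫ pullback.snd (terminal.from T') (terminal.from (Morphisms.projectiveSpaceInt ι))) (unitModule Z') e))
        f₀.appTop.hom ⊤) : ℕ) : ℚ) = r := by
  obtain ⟨H, hψ⟩ := isPullback_fieldPoint_and_twistMod_iso_of_isPullback_projectiveSpaceMap i v g i' Hg k' f₀ x' H'
  obtain ⟨hvan, hrk⟩ := h (k' ≫ g) H
  refine ⟨subsingleton_ext_of_iso₅ (unitModule X₀) (hψ e).some.symm 1 hvan, ?_⟩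
  obtain ⟨L, -⟩ := exists_secMod_linearEquiv_of_iso f₀.appTop.hom (hψ e).some
  rw [← L.finrank_eq]
  exact hrk

end Letters

/-! ## §5 The graph family of a `T`-morphism (after B-p14 (g20) `Morphisms/GraphFamilyEmbedding` 0bfc088a, by paste until ★) -/

section GraphFamilyPaste

variable {S Y X : Scheme.{0}} (q : Y ⟶ S) (p : X ⟶ S) {ι : Type} (jW : pullback q p ⟶ Morphisms.projectiveSpace ι S)
  {T : Scheme.{0}} (v : T ⟶ S) (φ : pullback q v ⟶ pullback p v) (hφ : φ ≫ pullback.snd p v = pullback.snd q v)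

include hφ in
/-- The graph point `(pr_Y, φ ≫ pr_X)` is well defined: `pr_Y ≫ q = (φ ≫ pr_X) ≫ p`. [cite: GortzWedhorn2020, Definition 9.7] -/
theorem fst_comp_eq_comp_fst_comp_of_over : pullback.fst q v ≫ q = (φ ≫ pullback.fst p v) ≫ p :=
  calc pullback.fst q v ≫ q = pullback.snd q v ≫ v := pullback.condition
    _ = (φ ≫ pullback.snd p v) ≫ v := by rw [hφ]
    _ = (φ ≫ pullback.fst p v) ≫ p := by rw [Category.assoc, Category.assoc, pullback.condition]

/-- **The graph family exists** (`𝐏(ι; T) = 𝐏(ι; S) ×_S T`): some `iΓ : Y_T ⟶ 𝐏(ι; T)` has `iΓ ≫ pr_T = pr_T` and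
`iΓ ≫ 𝐏(v) = (pr_Y, φ ≫ pr_X) ≫ jW`. [cite: StacksProject, Tag 01NF] [cite: GortzWedhorn2020, Section (4.12)] -/
theorem exists_graphFamily_of_over (hjW : jW ≫ Morphisms.projectiveSpaceFst ι S = pullback.fst q p ≫ q)
    (hw : pullback.fst q v ≫ q = (φ ≫ pullback.fst p v) ≫ p) :
    ∃ iΓ : pullback q v ⟶ Morphisms.projectiveSpace ι T,
      iΓ ≫ Morphisms.projectiveSpaceFst ι T = pullback.snd q v ∧
      iΓ ≫ Morphisms.projectiveSpaceMap ι v = pullback.lift (pullback.fst q v) (φ ≫ pullback.fst p v) hw ≫ jW := by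
  have HP := Morphisms.isPullback_projectiveSpaceMap ι v
  have hw' : (pullback.lift (pullback.fst q v) (φ ≫ pullback.fst p v) hw ≫ jW) ≫ Morphisms.projectiveSpaceFst ι S =
      pullback.snd q v ≫ v := by
    rw [Category.assoc, hjW, ← Category.assoc, pullback.lift_fst, pullback.condition]
  exact ⟨HP.lift _ _ hw', HP.lift_snd _ _ hw', HP.lift_fst _ _ hw'⟩

/-- **The graph family is a closed immersion** (a section of the separated projection `W_T → Y_T` followed by the closed immersion
`W_T ↪ 𝐏(ι; T)`, `W_T` the base change of `jW`; [GortzWedhorn2020] Def. 9.7 ∕ Ex. 9.11).  Proof after B-p14 (g20) `GraphFamilyEmbedding`.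
[cite: GortzWedhorn2020, Definition 9.7 and Example 9.11] [cite: MumfordFogartyKirwan1994, Ch. 0 §5 (c) (p. 23)] -/
theorem isClosedImmersion_graphFamily_of_over [IsClosedImmersion jW]
    (hjW : jW ≫ Morphisms.projectiveSpaceFst ι S = pullback.fst q p ≫ q)
    (hw : pullback.fst q v ≫ q = (φ ≫ pullback.fst p v) ≫ p)
    (iΓ : pullback q v ⟶ Morphisms.projectiveSpace ι T) (h₁ : iΓ ≫ Morphisms.projectiveSpaceFst ι T = pullback.snd q v)
    (h₂ : iΓ ≫ Morphisms.projectiveSpaceMap ι v = pullback.lift (pullback.fst q v) (φ ≫ pullback.fst p v) hw ≫ jW) :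
    IsClosedImmersion iΓ := by
  haveI : IsClosedImmersion (pullback.snd jW (Morphisms.projectiveSpaceMap ι v)) :=
    MorphismProperty.pullback_snd _ _ inferInstance
  let γ : pullback q v ⟶ pullback jW (Morphisms.projectiveSpaceMap ι v) :=
    pullback.lift (pullback.lift (pullback.fst q v) (φ ≫ pullback.fst p v) hw) iΓ h₂.symm
  have hγκ : γ ≫ pullback.snd jW (Morphisms.projectiveSpaceMap ι v) = iΓ := pullback.lift_snd _ _ _
  have hπw : (pullback.fst jW (Morphisms.projectiveSpaceMap ι v) ≫ pullback.fst q p) ≫ q =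
      (pullback.snd jW (Morphisms.projectiveSpaceMap ι v) ≫ Morphisms.projectiveSpaceFst ι T) ≫ v := by
    rw [Category.assoc, Category.assoc, ← Morphisms.projectiveSpaceMap_fst, ← Category.assoc (pullback.snd _ _),
      ← pullback.condition, Category.assoc, hjW]
  let π : pullback jW (Morphisms.projectiveSpaceMap ι v) ⟶ pullback q v :=
    pullback.lift (pullback.fst jW (Morphisms.projectiveSpaceMap ι v) ≫ pullback.fst q p)
      (pullback.snd jW (Morphisms.projectiveSpaceMap ι v) ≫ Morphisms.projectiveSpaceFst ι T) hπw
  have hγπ : γ ≫ π = 𝟙 _ := by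
    apply pullback.hom_ext
    · rw [Category.assoc, pullback.lift_fst, ← Category.assoc, pullback.lift_fst, pullback.lift_fst, Category.id_comp]
    · rw [Category.assoc, pullback.lift_snd, ← Category.assoc, pullback.lift_snd, h₁, Category.id_comp]
  haveI : IsSeparated π := by
    have hcomp : π ≫ pullback.snd q v =
        pullback.snd jW (Morphisms.projectiveSpaceMap ι v) ≫ Morphisms.projectiveSpaceFst ι T := pullback.lift_snd _ _ _
    haveI : IsSeparated (π ≫ pullback.snd q v) := by rw [hcomp]; infer_instance
    exact IsSeparated.of_comp π (pullback.snd q v)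
  haveI : IsClosedImmersion γ := by
    have : IsClosedImmersion (γ ≫ π) := by rw [hγπ]; infer_instance
    exact IsClosedImmersion.of_comp γ π
  rw [← hγκ]
  infer_instance

/-- The graph family is flat over `T` when `q` is (`iΓ ≫ pr_T = pr_T` is a base change of `q`). [cite: GortzWedhorn2020, Section (4.12)] -/
theorem flat_graphFamily_fst_of_over [Flat q] (iΓ : pullback q v ⟶ Morphisms.projectiveSpace ι T)
    (h₁ : iΓ ≫ Morphisms.projectiveSpaceFst ι T = pullback.snd q v) : Flat (iΓ ≫ Morphisms.projectiveSpaceFst ι T) := by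
  rw [h₁]; infer_instance

end GraphFamilyPaste

end Literature.AlgebraicGeometry.Morphisms

end
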